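import Summits.ABC.ABC.Theses.DefiniteXi
import Literature.NumberTheory.Automorphic.BrandtHeckeProjector
import HarnessLib

/-!
# An integral Hecke multiple of the eigen-projector exists
(stub `stub_heckeProjectorExists` (3a) of line `two-adic-redei-depth`, crux `XiBound`,
stmt-ABC-11336)

Let `S` be a Brandt setup of type `(N⁺, N⁻)` (definite quaternion algebra over `ℚ` of
discriminant `N⁻`, Eichler order `O` of level `N⁺`), `w_c = #O_L(I_c)ˣ / 2` the Gross weights on
the class set, `B(n)` the Brandt matrices, and suppose the eigen-lattice `L(λ) ⊆ ℤ^{Cls O}` of the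
`B(p)`, `p ∤ N⁺N⁻`, is the line `ℤ φ`, `φ ≠ 0`; `ξ = S.xi λ = Σ_c w_c φ_c²`.  Then there are
`D > 0` and a matrix `M` in the `ℤ`-algebra generated by ALL Brandt matrices `B(n)`, `n ≥ 1`, with
`ξ · M_cd = D · w_d φ_d φ_c` for all classes `c, d` — i.e. `M = D · π_φ` for the `w`-orthogonal
projector `π_φ = φ (w φ)ᵀ / ξ` onto `ℚ φ`.  The least such `D` is the congruence exponent of `φ`
in the integral Brandt–Hecke ring; the line's mechanism stub (3b) is a `2`-adic law for it, and
the skeleton feeds `Nat.find` of the present statement to it.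

This is pure algebra and is proved in the Literature as
`Literature.NumberTheory.Automorphic.Brandt.XiSetup.exists_heckeProjector_xi`
(`BrandtHeckeProjector.lean`): weight symmetry `w_i B(n)_ij = w_j B(n)_ji`
(`Brandt.XiSetup.weight_mul_matrix_symm`) and positivity `w_c ≥ 1`
(`Brandt.XiSetup.one_le_weight`) make `s = Σ_{p ∈ P} (B(p) − λ(p))²` (finitely many good
primes `P` cutting out the line) a `w`-self-adjoint operator with integer kernel `ℤ φ` and
`ker s² = ker s`; `minpoly_ℤ(s) = X · g` with `g(0) ≠ 0`, and `E = g(s)` satisfies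
`ξ · E = g(0) · φ (w φ)ᵀ`.  Here we only restate it in the stub's exact shape, and record the
specialisation to Frey curves.
-/

-- `Summit.<Summit>.<Problem>`: for the single-conjunct summit `ABC` the duplicate `ABC.ABC` is mandated.
set_option linter.dupNamespace false

noncomputable section

namespace Summit.ABC.ABC.Theorems

open Literature.NumberTheory.Automorphic

open scoped Classical in
/-- **Stub 3a of line `two-adic-redei-depth` — an integral HECKE multiple of the eigen-projector
exists.**  In any Brandt setup `S` of type `(N⁺, N⁻)`, for any eigenvalue system `λ` whose
eigen-lattice (primes `p ∤ N⁺N⁻`) is a line `ℤ φ`, `φ ≠ 0`, there are `D > 0` and `M` in the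
`ℤ`-algebra generated by all Brandt matrices `B(n)`, `n ≥ 1`, with `ξ · M_cd = D · w_d φ_d φ_c`
(`ξ = S.xi λ`), i.e. `M = D · π_φ`.  This is
`Literature.NumberTheory.Automorphic.Brandt.XiSetup.exists_heckeProjector_xi`. -/
theorem stub_heckeProjectorExists :
    ∀ {Nplus Nminus : ℕ} (S : Brandt.XiSetup Nplus Nminus) (lam : ℕ → ℤ)
      [Fintype (Brandt.ClassSet S.O)],
      ∀ φ : Brandt.ClassSet S.O → ℤ, φ ≠ 0 →
        Brandt.eigenLattice (Nplus * Nminus) (Brandt.matrix S.O) lam = ℤ ∙ φ →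
        ∃ D : ℕ, 0 < D ∧
          ∃ M ∈ Algebra.adjoin ℤ (Set.range fun n : ℕ => Brandt.matrix S.O (n + 1)),
            ∀ c d : Brandt.ClassSet S.O,
              (S.xi lam : ℤ) * M c d = (D : ℤ) * (Brandt.weight S.O d : ℤ) * φ d * φ c :=
  fun S lam _ φ hφ hL => Brandt.XiSetup.exists_heckeProjector_xi S lam φ hφ hL

open scoped Classical in
open Literature.NumberTheory.EllipticCurves in
/-- **Frey specialisation.**  For every `a, b, N, Nm`, every Brandt setup `S` of type `(N/Nm, Nm)`
and every generator `φ` of the `a(E_(a,b))`-eigen-line there are `D > 0` and `M` in the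
`ℤ`-algebra generated by all Brandt matrices with `ξ · M_cd = D · w_d φ_d φ_c` — with none of the
arithmetic hypotheses of the crux (coprimality, conductor, admissibility of `Nm`) needed.  The
least such `D`, `Nat.find` of this statement, is the quantity bounded by the mechanism stub
`stub_twoAdicLawMinimalExponent`. -/
theorem exists_heckeProjector_freyCurve (a b : ℤ) (N Nm : ℕ) (S : Brandt.XiSetup (N / Nm) Nm)
    [Fintype (Brandt.ClassSet S.O)] (φ : Brandt.ClassSet S.O → ℤ) (hφ : φ ≠ 0)
    (hL : Brandt.eigenLattice (N / Nm * Nm) (Brandt.matrix S.O)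
      (fun n => (freyCurve a b).LFunction n) = ℤ ∙ φ) :
    ∃ D : ℕ, 0 < D ∧
      ∃ M ∈ Algebra.adjoin ℤ (Set.range fun n : ℕ => Brandt.matrix S.O (n + 1)),
        ∀ c d : Brandt.ClassSet S.O,
          (S.xi (fun n => (freyCurve a b).LFunction n) : ℤ) * M c d =
            (D : ℤ) * (Brandt.weight S.O d : ℤ) * φ d * φ c :=
  stub_heckeProjectorExists S _ φ hφ hL

end Summit.ABC.ABC.Theorems

end
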